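import Summits.QuantumFields.BalabanUV.Beta.GAN24.OneStepLoopContractionMovingLegs
import Summits.QuantumFields.BalabanUV.Beta.GAN24.InsertionWordTwoPointDecay
import Summits.QuantumFields.BalabanUV.Beta.GAN24.InsertionWordVolumeLimitSides

/-!
# `BalabanUV.Beta.GAN24.OneStepLoopContractionLegs` — binder row G-an2-4 ∕ (CONV-C), routes C-R6° («VALUES») × R7 («TWO CURRENCIES»), PART 200:
# THE LEGS DISCHARGED — THE ONE-LOOP CONTRACTION `Γ_k(Y_k ⊗ₖ Y_k)Γ_kᴴ` OF THE GAUGE-FIXED LOOP COVARIANCE `Y = c⁻¹𝒢c⁻¹` WITH THE INSERTION-WORD LEGS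
# `Γ_k(x,(q,r)) = X_{x,k}(q,r)`, `X_{x,k} = L^{(d+1)k}Q_k(𝒢^{(k)}P(V_x)^{(k)}𝒢^{(k)})Q_kᴴ`, HAS THE β-CELL's WHOLE `LimitRate` END ON `ℤ^{d+1}` FOR EVERY LOCALISED LIPSCHITZ
# FAMILY OF UNIT BACKGROUNDS `(V_{t,x})` WITH POINTWISE LIMITS — census V196 (ζ) with the legs of V201‴ ((L-UD), (L-SR), (L-EL₃)) PROVED, not displayed: the level and
# step envelopes are PART 198's two-point decay about the insertion bond (`exists_twoPoint_insertion_rate`, volume-free, every torus), EL₃ is PART 199's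
# `tendsto_word_pair_mul` (the V197 junction: the socket volumes `fine (Lb·1) (cubic (2(t+1)))` ARE `cubic (Lb·1·2(t+1))`, a multiple of the even cubic volumes, on which an5's
# EL₂ of `𝒢^{(k)}` holds by transport), and the END is PART 197's `conv_oneLoop_loopCov_moving_of_rate` (`s = evenPeriod`).  Dimension `d + 1 ≥ 3` (an5), `L ≥ 2`, every `Lb ≥ 1`,
# every `a > 0`, every `(α, β, c₀)` (unit b2b-balaban-gan24-p3, gen 62; v1)

NOT IN PRINT; OUR PROOF ([folklore] bookkeeping BY NAME over PART 197 (`conv_oneLoop_loopCov_moving_of_rate`), PART 198 (`exists_twoPoint_insertion_rate`), PART 199 (`tendsto_word_pair_mul`),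
`CTKingTowerWeights.distK_comm`, the β-cell's `BlockKernelVolumeSockets.tendsto_evenPeriod`; [Balaban1987RG1] (1.20)–(1.22) p. 264 LOCATE the one-loop shape and the `T ↗ ℤ^d` limit;
nothing printed is a hypothesis).
HONEST FRAMING (cell contract, verbatim): «discharging `BetaPertH` makes Bałaban's UV stability UNCONDITIONAL — a real constructive-QFT result; it is NOT the
continuum limit and NOT the Clay problem.»  HONEST DEPENDENCY (verbatim): «continuum YM on T⁴ ⇐ BetaPertH ∧ nine spine estimates (0/9 proved); BetaPertH ⇐
(D1) ∧ (D4) ∧ CAP+tail; G-an2-4 gates asym, D1 and NE2/3/4.»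

WHAT THIS FILE PROVES (0 sorry, 0 `def`; `M_t = fine (Lb·1) (cubic (d+1) (s t))`, `X_{t,x,k} = avgTow (QBlev L M_t) (L^{d+1}) (k ↦ 𝒢_kP(V_{t,x})_k𝒢_k) k`,
`Γ_{t,k} = Matrix.of (x, (q,r)) ↦ X_{t,x,k}(q,r)`, `e = unitIdx⁻¹`, `ρ_{k,i} = rho k i`):
* §1 **`insertionLegs_envelopes`** — (L-UD)+(L-SR) IN PART 197's SHAPE, every coarse volume family `s`: `∃ κ > 0, B, B′ ≥ 0` from `(d, L, a, α, β, c₀)` with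
  `‖Γ_{t,k}(x,(q,r))‖ ≤ B·e^{−κ(distK(x,q) + distK(x,r))}` and `‖(Γ_{t,k+1} − Γ_{t,k})(x,(q,r))‖ ≤ B′·(√(L⁻¹))^k·e^{−κ(…)}` for every family of `LipschitzBackground`s `V_{t,x}` (common
  `(α, β)`) supported where `ρ_{k,x} ≤ c₀`.
* §2 **`insertionLegs_tendsto`** — (L-EL₃) (`d + 1 ≥ 3`, `s = evenPeriod`): the entries `Γ_{t,k}(e(ẑ,μ′),(e(û,l), e(v̂,l′)))` converge for all integer `z, u, v`, from EL₁ of the backgrounds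
  about every integer root (`V_{t,e(ẑ,μ′)}` at fine integer readings).
* §3 **`conv_oneLoop_loopCov_insertionLegs`** — THE END: `∃ κ₁ > 0, C, C′ ≥ 0, Π` with `IsInfiniteVolumeLimit (Lb·1·2(t+1)) (Re (Γ_{t,k}(Y_{t,k} ⊗ₖ Y_{t,k})Γ_{t,k}ᴴ)(e(·,μ′),e(0,ν′))) (Π k)`,
  `UniformDecay Π μ ν C ((κ₁∕4)∕(d+1))`, `StepRate Π μ ν C′ ((κ₁∕4)∕(d+1)) (√(L⁻¹))`, `KernelInputs`, second-moment convergence — for EVERY localised Lipschitz family with pointwise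
  limits; NO residual hypothesis on the legs.
WHAT IT DOES NOT DO: the INDICATOR family `V_{t,x} = 1_{block x}` (not Lipschitz at its own spacing: its step envelope is the located analysis item of census V201‴; its level
envelope IS PART 198 §3); the identification `tr(Y X_i Y X_j) = (Γ(Y ⊗ₖ Y)Γᴴ)(i,j)` (cyclicity + symmetry, row an1's dictionary) and of these words with Bałaban's `Π⁰`; the tadpoles;
first-order MODEL framing unchanged (NOT Bałaban's `Δ^{(k)}(U)` with a background).  SUPPLIER work; NEVER «G-an2-4 closed»; NOT (CONV-C), NOT D1, NOT `BetaPertH`, NOT continuum,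
NOT Clay.  Records: `HOME/b2b-balaban-gan24-p3/gen62/README.md`.
-/

noncomputable section

open scoped BigOperators ComplexConjugate Matrix Matrix.Norms.L2Operator Kronecker
open Filter Topology Finset Matrix

namespace Summit.QuantumFields.BalabanUV.Beta.GAN24.OneStepLoopContractionLegs

open Literature.MathematicalPhysics.QuantumFieldTheory.Balaban1983to89
open Literature.MathematicalPhysics.QuantumFieldTheory.Balaban1983to89.B5Prop11Plancherel (Tor fine)
open Literature.MathematicalPhysics.QuantumFieldTheory.Balaban1983to89.B5RealFields (reM)
open Literature.MathematicalPhysics.QuantumFieldTheory.Balaban1983to89.B5G183RateUnitTower (lev)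
open Literature.MathematicalPhysics.QuantumFieldTheory.Balaban1983to89.B12Sec2to5 (betaPrime510)
open Literature.MathematicalPhysics.QuantumFieldTheory.Balaban1983to89.Beta (IsInfiniteVolumeLimit)
open Literature.MathematicalPhysics.QuantumFieldTheory.Balaban1983to89.Beta.FreeLegDictionary (cubic)
open Literature.MathematicalPhysics.QuantumFieldTheory.Balaban1983to89.Beta.BlockKernelVolumeSockets (evenPeriod tendsto_evenPeriod)
open Literature.MathematicalPhysics.QuantumFieldTheory.Balaban1983to89.Beta.VectorTails (castT)
open Literature.MathematicalPhysics.QuantumFieldTheory.Balaban1983to89.Beta.LimitRate (StepRate limKernelOf KernelInputs)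
open Literature.MathematicalPhysics.QuantumFieldTheory.Balaban1983to89.Beta.CompositionSingular (flucCov)
open Literature.MathematicalPhysics.QuantumFieldTheory.Balaban1983to89.Beta.BlockEffectiveAction (DelK)
open Summit.QuantumFields.BalabanUV.T4Continuum.BalabanLineAverage (QB)
open Summit.QuantumFields.BalabanUV.T4Continuum.BalabanAveragedTowerModes (par rem)
open Summit.QuantumFields.BalabanUV.T4Continuum.CovariantAveragingTower (avgTow)
open Summit.QuantumFields.BalabanUV.T4Continuum.BalabanAveragedTowerUnit (idx QBlev calGlev unitCovB one_le_lev')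
open Summit.QuantumFields.BalabanUV.T4Continuum.BalabanAveragedCoerciveTower (unitIdx)
open Summit.QuantumFields.BalabanUV.T4Continuum.CTKingTowerWeights (rho distK distK_comm)
open Summit.QuantumFields.BalabanUV.T4Continuum.FirstOrderBackgroundModel (LipschitzBackground Pmodel)
open Summit.QuantumFields.BalabanUV.Beta.GAN24.OneStepLoopContractionMovingLegs (conv_oneLoop_loopCov_moving_of_rate)
open Summit.QuantumFields.BalabanUV.Beta.GAN24.InsertionWordTwoPointDecay (exists_twoPoint_insertion_rate)
open Summit.QuantumFields.BalabanUV.Beta.GAN24.InsertionWordVolumeLimitSides (tendsto_word_pair_mul)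

variable {d : ℕ} (L : ℕ) [NeZero L] (Lb : ℕ) [NeZero Lb] (a : ℝ) (ha : 0 < a)

/-! ## §1 (L-UD)+(L-SR): the level and step envelopes of the insertion-word legs, every coarse volume family -/

/-- **`insertionLegs_envelopes` — THE TWO LEG ENVELOPES OF PART 197 FOR THE INSERTION-WORD LEGS, EVERY COARSE VOLUME FAMILY** [our proof] (`L ≥ 2`; dimension `d + 1 ≥ 1`): `∃ κ > 0,
B, B′ ≥ 0` depending on `(d, L, a, α, β, c₀)` only such that for EVERY coarse volume family `s`, EVERY family `V_{t,x}` of `LipschitzBackground`s with common `(α, β)` supported where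
`ρ_{k,x} ≤ c₀`, and all `t, k, x, (q,r)`: `‖Γ_{t,k}(x,(q,r))‖ ≤ B·e^{−κ(distK(x,q) + distK(x,r))}` and `‖(Γ_{t,k+1} − Γ_{t,k})(x,(q,r))‖ ≤ B′·(√(L⁻¹))^k·e^{−κ(distK(x,q) + distK(x,r))}` —
PART 198's `exists_twoPoint_insertion_rate` on the torus `M_t`, bond `x`, background `V_{t,x}` (`distK` is symmetric). -/
theorem insertionLegs_envelopes (hL : 2 ≤ L) (α β c₀ : ℝ) :
    ∃ κ B B' : ℝ, 0 < κ ∧ 0 ≤ B ∧ 0 ≤ B' ∧ ∀ (s : ℕ → ℕ) [∀ t, NeZero (s t)] (V : (t : ℕ) → idx L (fine (Lb * 1) (cubic (d + 1) (s t))) 0 → (k : ℕ) → Fin (d + 1) → (idx L (fine (Lb * 1) (cubic (d + 1) (s t))) k → ℂ)),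
      (∀ t i, LipschitzBackground L (fine (Lb * 1) (cubic (d + 1) (s t))) (V t i) α β) → (∀ t i k μ u, V t i k μ u ≠ 0 → rho L (fine (Lb * 1) (cubic (d + 1) (s t))) k i u ≤ c₀) →
      (∀ t k x q, ‖(Matrix.of fun (x : idx L (fine (Lb * 1) (cubic (d + 1) (s t))) 0) (q : idx L (fine (Lb * 1) (cubic (d + 1) (s t))) 0 × idx L (fine (Lb * 1) (cubic (d + 1) (s t))) 0) => avgTow (QBlev L (fine (Lb * 1) (cubic (d + 1) (s t)))) ((L : ℝ) ^ (d + 1)) (fun k => calGlev L (fine (Lb * 1) (cubic (d + 1) (s t))) a ha k * Pmodel L (fine (Lb * 1) (cubic (d + 1) (s t))) (V t x) k * calGlev L (fine (Lb * 1) (cubic (d + 1) (s t))) a ha k) k q.1 q.2) x q‖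
        ≤ B * Real.exp (-(κ * (distK L (fine (Lb * 1) (cubic (d + 1) (s t))) x q.1 + distK L (fine (Lb * 1) (cubic (d + 1) (s t))) x q.2)))) ∧
      (∀ t k x q, ‖((Matrix.of fun (x : idx L (fine (Lb * 1) (cubic (d + 1) (s t))) 0) (q : idx L (fine (Lb * 1) (cubic (d + 1) (s t))) 0 × idx L (fine (Lb * 1) (cubic (d + 1) (s t))) 0) => avgTow (QBlev L (fine (Lb * 1) (cubic (d + 1) (s t)))) ((L : ℝ) ^ (d + 1)) (fun k => calGlev L (fine (Lb * 1) (cubic (d + 1) (s t))) a ha k * Pmodel L (fine (Lb * 1) (cubic (d + 1) (s t))) (V t x) k * calGlev L (fine (Lb * 1) (cubic (d + 1) (s t))) a ha k) (k + 1) q.1 q.2)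
          - (Matrix.of fun (x : idx L (fine (Lb * 1) (cubic (d + 1) (s t))) 0) (q : idx L (fine (Lb * 1) (cubic (d + 1) (s t))) 0 × idx L (fine (Lb * 1) (cubic (d + 1) (s t))) 0) => avgTow (QBlev L (fine (Lb * 1) (cubic (d + 1) (s t)))) ((L : ℝ) ^ (d + 1)) (fun k => calGlev L (fine (Lb * 1) (cubic (d + 1) (s t))) a ha k * Pmodel L (fine (Lb * 1) (cubic (d + 1) (s t))) (V t x) k * calGlev L (fine (Lb * 1) (cubic (d + 1) (s t))) a ha k) k q.1 q.2)) x q‖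
        ≤ B' * Real.sqrt ((L : ℝ)⁻¹) ^ k * Real.exp (-(κ * (distK L (fine (Lb * 1) (cubic (d + 1) (s t))) x q.1 + distK L (fine (Lb * 1) (cubic (d + 1) (s t))) x q.2)))) := by
  obtain ⟨κ, B, B', hκ, hB, hB', h⟩ := exists_twoPoint_insertion_rate L a ha (d := d + 1) hL (by omega) α β c₀
  refine ⟨κ, B, B', hκ, hB, hB', fun s _ V hV hloc => ⟨fun t k x q => ?_, fun t k x q => ?_⟩⟩
  · rw [Matrix.of_apply, distK_comm L _ x q.1, distK_comm L _ x q.2]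
    exact (h (fine (Lb * 1) (cubic (d + 1) (s t))) x (V t x) (hV t x) (hloc t x)).1 k q.1 q.2
  · rw [Matrix.sub_apply, Matrix.of_apply, Matrix.of_apply, ← Matrix.sub_apply, distK_comm L _ x q.1, distK_comm L _ x q.2]
    exact (h (fine (Lb * 1) (cubic (d + 1) (s t))) x (V t x) (hV t x) (hloc t x)).2 k q.1 q.2

/-! ## §2 (L-EL₃): the entries of the insertion-word legs at integer triples converge along the socket volumes `Lb·1·2(t+1)` -/

/-- **`insertionLegs_tendsto` — EL₃ OF THE INSERTION-WORD LEGS ALONG THE SOCKET VOLUMES, MODULO EL₁ OF THE BACKGROUNDS ABOUT INTEGER ROOTS** [our proof] (`d + 1 ≥ 3`, `s = evenPeriod`):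
if for every integer root `(z, μ′)` the backgrounds `V_{t, e(ẑ_t, μ′)}` converge at fine integer readings (all levels, components), then for all `k, μ′, l, l′, z, u, v` the leg entry
`Γ_{t,k}(e(ẑ,μ′),(e(û,l), e(v̂,l′)))` converges — PART 199's `tendsto_word_pair_mul` for the one-letter word over the background family `t ↦ V_{t, e(ẑ_t, μ′)}` with `m = Lb·1`
(`M_t = cubic (Lb·1·evenPeriod t)` definitionally). [cite: Balaban1987RG1, p.264 (after (1.21): the `T ↗ ℤ^d` limit)] -/
theorem insertionLegs_tendsto (hd : 2 ≤ d) {α β : ℝ} {V : (t : ℕ) → idx L (fine (Lb * 1) (cubic (d + 1) (evenPeriod t))) 0 → (k : ℕ) → Fin (d + 1) → (idx L (fine (Lb * 1) (cubic (d + 1) (evenPeriod t))) k → ℂ)}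
    (hV : ∀ t i, LipschitzBackground L (fine (Lb * 1) (cubic (d + 1) (evenPeriod t))) (V t i) α β)
    (hel : ∀ (z : Fin (d + 1) → ℤ) (μ' : Fin (d + 1)) (k : ℕ) (μ f : Fin (d + 1)) (w : Fin (d + 1) → ℤ), ∃ s : ℂ,
      Tendsto (fun t => V t ((unitIdx L (fine (Lb * 1) (cubic (d + 1) (evenPeriod t)))).symm (castT (fine (Lb * 1) (cubic (d + 1) (evenPeriod t))) z, μ')) k μ (castT (fine (lev L k) (fine (Lb * 1) (cubic (d + 1) (evenPeriod t)))) w, f)) atTop (𝓝 s)) (k : ℕ) (μ' l l' : Fin (d + 1)) (z u v : Fin (d + 1) → ℤ) :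
    ∃ s' : ℂ, Tendsto (fun t => (Matrix.of fun (x : idx L (fine (Lb * 1) (cubic (d + 1) (evenPeriod t))) 0) (q : idx L (fine (Lb * 1) (cubic (d + 1) (evenPeriod t))) 0 × idx L (fine (Lb * 1) (cubic (d + 1) (evenPeriod t))) 0) => avgTow (QBlev L (fine (Lb * 1) (cubic (d + 1) (evenPeriod t)))) ((L : ℝ) ^ (d + 1)) (fun k => calGlev L (fine (Lb * 1) (cubic (d + 1) (evenPeriod t))) a ha k * Pmodel L (fine (Lb * 1) (cubic (d + 1) (evenPeriod t))) (V t x) k * calGlev L (fine (Lb * 1) (cubic (d + 1) (evenPeriod t))) a ha k) k q.1 q.2)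
      ((unitIdx L (fine (Lb * 1) (cubic (d + 1) (evenPeriod t)))).symm (castT (fine (Lb * 1) (cubic (d + 1) (evenPeriod t))) z, μ')) (((unitIdx L (fine (Lb * 1) (cubic (d + 1) (evenPeriod t)))).symm (castT (fine (Lb * 1) (cubic (d + 1) (evenPeriod t))) u, l)), ((unitIdx L (fine (Lb * 1) (cubic (d + 1) (evenPeriod t)))).symm (castT (fine (Lb * 1) (cubic (d + 1) (evenPeriod t))) v, l')))) atTop (𝓝 s') := by
  obtain ⟨s', hs'⟩ := tendsto_word_pair_mul L a ha (d := d + 1) (by omega) (Lb * 1) k (σ := Unit)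
    (V := fun _ t => V t ((unitIdx L (fine (Lb * 1) (cubic (d + 1) (evenPeriod t)))).symm (castT (fine (Lb * 1) (cubic (d + 1) (evenPeriod t))) z, μ'))) (fun _ t => hV t _) (fun _ μ f w => hel z μ' k μ f w) [()] l l' u v
  exact ⟨s', hs'.congr fun t => rfl⟩

/-! ## §3 THE END: the one-loop contraction of `Y = c⁻¹𝒢c⁻¹` with the insertion-word legs on `ℤ^{d+1}` -/

/-- **`conv_oneLoop_loopCov_insertionLegs` — CENSUS V196 (ζ) WITH ITS LEGS DISCHARGED: THE ONE-LOOP CONTRACTION `Γ_k(Y_k ⊗ₖ Y_k)Γ_kᴴ` OF THE GAUGE-FIXED LOOP COVARIANCE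
`Y = c⁻¹𝒢c⁻¹` WITH THE INSERTION-WORD LEGS `Γ_k(x,(q,r)) = X_{x,k}(q,r)` ON `ℤ^{d+1}`, FOR EVERY LOCALISED LIPSCHITZ FAMILY OF UNIT BACKGROUNDS WITH POINTWISE LIMITS** [our proof]
(`d + 1 ≥ 3`, `L ≥ 2`, every `Lb ≥ 1`, `a > 0`, `μ ≠ ν`, coarse volumes `2(t+1)`, `M_t = fine (Lb·1) (cubic (2(t+1)))`; backgrounds `V_{t,x}` with common `(α, β)`, supported where
`ρ_{k,x} ≤ c₀`, converging at fine integer readings about every integer root): `∃ κ₁ > 0, C, C′ ≥ 0, Π` with `IsInfiniteVolumeLimit (Lb·1·2(t+1))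
(Re (Γ_{t,k}(Y_{t,k} ⊗ₖ Y_{t,k})Γ_{t,k}ᴴ)(e(·,μ′),e(0,ν′))) (Π k)`, `UniformDecay Π μ ν C ((κ₁∕4)∕(d+1))`, `StepRate Π μ ν C′ ((κ₁∕4)∕(d+1)) (√(L⁻¹))`, `KernelInputs (d+1) Π`,
`∀ k, |secondMoment (Π k) μ ν − secondMoment (limKernelOf Π) μ ν| ≤ β′_{d+1}(C′∕(1−√(L⁻¹)), (κ₁∕4)∕(d+1))·(√(L⁻¹))^k` — PART 197's socket fed with §1 (both legs the same family, rate
`κ_Γ` = §1's `κ`) and §2; the auxiliary regularisation mass of PART 195 is taken `= 1`.  NO residual hypothesis on the legs. [cite: Balaban1987RG1, (1.20)–(1.22) p.264 (shapes)] -/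
theorem conv_oneLoop_loopCov_insertionLegs (hL : 2 ≤ L) (hd : 2 ≤ d) {μ ν : Fin (d + 1)} (hne : μ ≠ ν) {α β c₀ : ℝ}
    {V : (t : ℕ) → idx L (fine (Lb * 1) (cubic (d + 1) (evenPeriod t))) 0 → (k : ℕ) → Fin (d + 1) → (idx L (fine (Lb * 1) (cubic (d + 1) (evenPeriod t))) k → ℂ)}
    (hV : ∀ t i, LipschitzBackground L (fine (Lb * 1) (cubic (d + 1) (evenPeriod t))) (V t i) α β)
    (hloc : ∀ t i k μ u, V t i k μ u ≠ 0 → rho L (fine (Lb * 1) (cubic (d + 1) (evenPeriod t))) k i u ≤ c₀)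
    (hel : ∀ (z : Fin (d + 1) → ℤ) (μ' : Fin (d + 1)) (k : ℕ) (μ f : Fin (d + 1)) (w : Fin (d + 1) → ℤ), ∃ s : ℂ,
      Tendsto (fun t => V t ((unitIdx L (fine (Lb * 1) (cubic (d + 1) (evenPeriod t)))).symm (castT (fine (Lb * 1) (cubic (d + 1) (evenPeriod t))) z, μ')) k μ (castT (fine (lev L k) (fine (Lb * 1) (cubic (d + 1) (evenPeriod t)))) w, f)) atTop (𝓝 s)) :
    ∃ κ₁ C C' : ℝ, 0 < κ₁ ∧ 0 ≤ C ∧ 0 ≤ C' ∧ ∃ Pinf : ℕ → B12Beta.Kernel (d + 1),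
      (∀ k, IsInfiniteVolumeLimit (fun t => Lb * 1 * evenPeriod t)
        (fun t μ' ν' (z : Beta.Site (d + 1) (Lb * 1 * evenPeriod t)) => (((Matrix.of fun (x : idx L (fine (Lb * 1) (cubic (d + 1) (evenPeriod t))) 0) (q : idx L (fine (Lb * 1) (cubic (d + 1) (evenPeriod t))) 0 × idx L (fine (Lb * 1) (cubic (d + 1) (evenPeriod t))) 0) => avgTow (QBlev L (fine (Lb * 1) (cubic (d + 1) (evenPeriod t)))) ((L : ℝ) ^ (d + 1)) (fun k => calGlev L (fine (Lb * 1) (cubic (d + 1) (evenPeriod t))) a ha k * Pmodel L (fine (Lb * 1) (cubic (d + 1) (evenPeriod t))) (V t x) k * calGlev L (fine (Lb * 1) (cubic (d + 1) (evenPeriod t))) a ha k) k q.1 q.2) * ((((unitCovB L (fine (Lb * 1) (cubic (d + 1) (evenPeriod t))) a ha k)⁻¹ * (((flucCov (reM (DelK (lev L k) (one_le_lev' L k) (fine (Lb * 1) (cubic (d + 1) (evenPeriod t))) a ha)) (Matrix.fromRows (reM (QB 1 Lb (cubic (d + 1) (evenPeriod t)))) (fun (t' : {x : Tor (fine (Lb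 * 1) (cubic (d + 1) (evenPeriod t))) × Fin (d + 1) // (∀ ν, ν < x.2 → ((rem 1 Lb (cubic (d + 1) (evenPeriod t)) x.1 ν : ℕ)) = 0) ∧ ((rem 1 Lb (cubic (d + 1) (evenPeriod t)) x.1 x.2 : ℕ)) + 1 < Lb}) (x : Tor (fine (Lb * 1) (cubic (d + 1) (evenPeriod t))) × Fin (d + 1)) => if x = (Function.Embedding.subtype (fun x : Tor (fine (Lb * 1) (cubic (d + 1) (evenPeriod t))) × Fin (d + 1) => (∀ ν, ν < x.2 → ((rem 1 Lb (cubic (d + 1) (evenPeriod t)) x.1 ν : ℕ)) = 0) ∧ ((rem 1 Lb (cubic (d + 1) (evenPeriod t)) x.1 x.2 : ℕ)) + 1 < Lb)) t' then (1 : ℝ) else 0))).map ((↑) : ℝ → ℂ)).submatrix (unitIdx L (fine (Lb * 1) (cubic (d + 1) (evenPeriod t)))) (unitIdx L (fine (Lb * 1) (cubic (d + 1) (evenPeriod t))))) * (unitCovB L (fine (Lb * 1) (cubic (d + 1) (evenPeriod t))) a ha k)⁻¹)) ⊗ₖ (((unitCovB L (fine (Lb * 1) (cubic (d + 1) (evenPeriod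 t))) a ha k)⁻¹ * (((flucCov (reM (DelK (lev L k) (one_le_lev' L k) (fine (Lb * 1) (cubic (d + 1) (evenPeriod t))) a ha)) (Matrix.fromRows (reM (QB 1 Lb (cubic (d + 1) (evenPeriod t)))) (fun (t' : {x : Tor (fine (Lb * 1) (cubic (d + 1) (evenPeriod t))) × Fin (d + 1) // (∀ ν, ν < x.2 → ((rem 1 Lb (cubic (d + 1) (evenPeriod t)) x.1 ν : ℕ)) = 0) ∧ ((rem 1 Lb (cubic (d + 1) (evenPeriod t)) x.1 x.2 : ℕ)) + 1 < Lb}) (x : Tor (fine (Lb * 1) (cubic (d + 1) (evenPeriod t))) × Fin (d + 1)) => if x = (Function.Embedding.subtype (fun x : Tor (fine (Lb * 1) (cubic (d + 1) (evenPeriod t))) × Fin (d + 1) => (∀ ν, ν < x.2 → ((rem 1 Lb (cubic (d + 1) (evenPeriod t)) x.1 ν : ℕ)) = 0) ∧ ((rem 1 Lb (cubic (d + 1) (evenPeriod t)) x.1 x.2 : ℕ)) + 1 < Lb)) t' then (1 : ℝ) else 0))).map ((↑) : ℝ → ℂ)).submatrix (unitIdx L (fine (Lb * 1) (cubic (d +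 1) (evenPeriod t)))) (unitIdx L (fine (Lb * 1) (cubic (d + 1) (evenPeriod t))))) * (unitCovB L (fine (Lb * 1) (cubic (d + 1) (evenPeriod t))) a ha k)⁻¹))) * ((Matrix.of fun (x : idx L (fine (Lb * 1) (cubic (d + 1) (evenPeriod t))) 0) (q : idx L (fine (Lb * 1) (cubic (d + 1) (evenPeriod t))) 0 × idx L (fine (Lb * 1) (cubic (d + 1) (evenPeriod t))) 0) => avgTow (QBlev L (fine (Lb * 1) (cubic (d + 1) (evenPeriod t)))) ((L : ℝ) ^ (d + 1)) (fun k => calGlev L (fine (Lb * 1) (cubic (d + 1) (evenPeriod t))) a ha k * Pmodel L (fine (Lb * 1) (cubic (d + 1) (evenPeriod t))) (V t x) k * calGlev L (fine (Lb * 1) (cubic (d + 1) (evenPeriod t))) a ha k) k q.1 q.2))ᴴ) ((unitIdx L (fine (Lb * 1) (cubic (d + 1) (evenPeriod t)))).symm (z, μ')) ((unitIdx L (fine (Lb * 1) (cubic (d + 1) (evenPeriod t)))).symm (0, ν'))).re) (Pinf k)) ∧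
      Beta.LimitRate.UniformDecay Pinf μ ν C ((κ₁ / 4) / (((d + 1 : ℕ)) : ℝ)) ∧
      StepRate Pinf μ ν C' ((κ₁ / 4) / (((d + 1 : ℕ)) : ℝ)) (Real.sqrt ((L : ℝ)⁻¹)) ∧
      (∃ K : KernelInputs (d + 1) Pinf, K.θ = Real.sqrt ((L : ℝ)⁻¹) ∧ K.c₀ = betaPrime510 (d + 1) (C' / (1 - Real.sqrt ((L : ℝ)⁻¹))) ((κ₁ / 4) / (((d + 1 : ℕ)) : ℝ)) ∧
        K.Pinf = limKernelOf Pinf ∧ K.μ = μ ∧ K.ν = ν) ∧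
      (∀ k, |B12Beta.secondMoment (Pinf k) μ ν - B12Beta.secondMoment (limKernelOf Pinf) μ ν|
          ≤ betaPrime510 (d + 1) (C' / (1 - Real.sqrt ((L : ℝ)⁻¹))) ((κ₁ / 4) / (((d + 1 : ℕ)) : ℝ)) * Real.sqrt ((L : ℝ)⁻¹) ^ k) := by
  obtain ⟨κΓ, B, B', hκΓ, hB, hB', henv⟩ := insertionLegs_envelopes L Lb a ha hL α β c₀
  obtain ⟨h1, h2⟩ := henv evenPeriod V hV hloc
  obtain ⟨κ₁, C, C', hκ₁, -, hC, hC', h⟩ := conv_oneLoop_loopCov_moving_of_rate (L := L) (Lb := Lb) (a := a) (ha := ha) (s := evenPeriod) hL (by omega)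
    tendsto_evenPeriod (a' := 1) one_pos hne hκΓ
  obtain ⟨Pinf, hP⟩ := h B B B' B' hB hB hB' hB'
    (fun t k => (Matrix.of fun (x : idx L (fine (Lb * 1) (cubic (d + 1) (evenPeriod t))) 0) (q : idx L (fine (Lb * 1) (cubic (d + 1) (evenPeriod t))) 0 × idx L (fine (Lb * 1) (cubic (d + 1) (evenPeriod t))) 0) => avgTow (QBlev L (fine (Lb * 1) (cubic (d + 1) (evenPeriod t)))) ((L : ℝ) ^ (d + 1)) (fun k => calGlev L (fine (Lb * 1) (cubic (d + 1) (evenPeriod t))) a ha k * Pmodel L (fine (Lb * 1) (cubic (d + 1) (evenPeriod t))) (V t x) k * calGlev L (fine (Lb * 1) (cubic (d + 1) (evenPeriod t))) a ha k) k q.1 q.2))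
    (fun t k => (Matrix.of fun (x : idx L (fine (Lb * 1) (cubic (d + 1) (evenPeriod t))) 0) (q : idx L (fine (Lb * 1) (cubic (d + 1) (evenPeriod t))) 0 × idx L (fine (Lb * 1) (cubic (d + 1) (evenPeriod t))) 0) => avgTow (QBlev L (fine (Lb * 1) (cubic (d + 1) (evenPeriod t)))) ((L : ℝ) ^ (d + 1)) (fun k => calGlev L (fine (Lb * 1) (cubic (d + 1) (evenPeriod t))) a ha k * Pmodel L (fine (Lb * 1) (cubic (d + 1) (evenPeriod t))) (V t x) k * calGlev L (fine (Lb * 1) (cubic (d + 1) (evenPeriod t))) a ha k) k q.1 q.2))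
    h1 h1 h2 h2 (fun k μ' l l' z u v => insertionLegs_tendsto L Lb a ha hd hV hel k μ' l l' z u v)
    (fun k μ' l l' z u v => insertionLegs_tendsto L Lb a ha hd hV hel k μ' l l' z u v)
  exact ⟨κ₁, B * B * C, (B' * B + B * B') * C + B * B * C', hκ₁, by positivity, by positivity, Pinf, hP⟩

end Summit.QuantumFields.BalabanUV.Beta.GAN24.OneStepLoopContractionLegs

end
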